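import Summits.Ventures.YMGap.Thresholds.StarLimitTorus
import Literature.MathematicalPhysics.QuantumFieldTheory.LatticeGaugeDobrushin
import HarnessLib

/-!
# Venture YMGap — track (c) «DS»: Lipschitz cylinder functions of `ℤ⁴` on the torus and in the limit —
# the star door for `IsLipschitzCylinder` observables (tools for `StarLimitClustering.lean`)

HONEST FRAMING: venture file (cell `pub-ymgap`, PLAN R99/R101–R103), strong-coupling LATTICE
bookkeeping only.  INPUT: the hypothesis schema `StarWindowBound L β_W ρ r` (`StarWindow.lean`) on a
torus, `ρ < 1`.  OUTPUT, kernel-checked GIVEN that input: (i) a Lipschitz cylinder function of `ℤ^d`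
(`IsLipschitzCylinder (fundamentalRep (Fin N)) F Λ K`, the observables of the tree's `shen_zhu_zhu` /
`Summit.Ventures.YMGap.MassGapAt`) read through the periodic lift is an admissible link observable of the
torus with per-link constant `K` for the Frobenius weight, once `torusEdge L` is injective on `Λ`
(`linkObs_toTorusObservable`); (ii) ds-1's star door `DSWindow.su2Star_abs_covariance_le` then bounds
the torus covariance of two such observables by `4(2√2)² e^{−κ(ρ)(m−2)} (#Λ₁K₁)(#Λ₂K₂)` when the
projected base points are `≥ m` apart (`su2Star_torus_cov_lipschitz`; no separation of supports
needed); (iii) covariance bounds valid on all large tori of the defining subsequence pass to an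
infinite-volume limit state for continuous cylinder observables (`abs_cov_le_of_eventually_torus`).
Nothing about uniqueness, the continuum, confinement or a transfer-matrix gap.
-/

noncomputable section

open MeasureTheory ProbabilityTheory Function Finset Filter Topology
open scoped NNReal
open Literature.Probability.LatticeModels
open Literature.Probability.LatticeModels.DobrushinMetric
open Literature.MathematicalPhysics.QuantumLattice (toTorusObservable toTorusObservable_apply IsCylinder
  LGConfig torusLift torusEdge fundamentalRep infiniteVolumeLimitPoints IsInfiniteVolumeLimitAlong
  ymSpecification ymGibbsMeasures continuous_fundamentalRep)
open Literature.MathematicalPhysics.QuantumFieldTheory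
open Literature.MathematicalPhysics.QuantumFieldTheory.Balaban1983to89
open Literature.MathematicalPhysics.QuantumFieldTheory.Balaban1983to89.StrongCouplingTorusWindow
open Summit.Ventures.YMGap.DSWindow

namespace Summit.Ventures.YMGap.StarLimit

/-! ### The weak-limit step for covariances -/

section WeakLimit

variable {d N : ℕ} {G : Type*} [Group G] [TopologicalSpace G] [IsTopologicalGroup G]
  [CompactSpace G] [MeasurableSpace G] [BorelSpace G] (ρG : G →* Matrix (Fin N) (Fin N) ℂ)

/-- **Covariance bounds pass to the infinite-volume limit**: if `μ` is the limit of the torus Wilson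
states along `L_k + 1` and `Φ₁, Φ₂` are bounded measurable CONTINUOUS cylinder observables of `ℤ^d`,
a bound `b` on the torus covariances of `Φ₁ ∘ lift, Φ₂ ∘ lift` valid for all large `k` bounds
`|cov_μ(Φ₁, Φ₂)|`. -/
theorem abs_cov_le_of_eventually_torus {β : ℝ} {μ : Measure (LGConfig d G)} {Lseq : ℕ → ℕ}
    (hμL : IsInfiniteVolumeLimitAlong (d := d) ρG β Lseq μ)
    {Φ₁ Φ₂ : LGConfig d G → ℝ} (h₁c : Continuous Φ₁) (h₂c : Continuous Φ₂) (h₁m : Measurable Φ₁)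
    (h₂m : Measurable Φ₂) {T₁ T₂ : Finset (Literature.MathematicalPhysics.QuantumLattice.ZdEdge d)}
    (h₁T : IsCylinder Φ₁ T₁) (h₂T : IsCylinder Φ₂ T₂) {M₁ M₂ : ℝ} (hM₁ : ∀ U, |Φ₁ U| ≤ M₁)
    (hM₂ : ∀ U, |Φ₂ U| ≤ M₂) {b : ℝ}
    (hB : ∀ᶠ k in atTop,
      |(∫ V, toTorusObservable (Lseq k + 1) Φ₁ V * toTorusObservable (Lseq k + 1) Φ₂ V
            ∂(wilsonMeasure (d := d) (L := Lseq k + 1) ρG β)) -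
          (∫ V, toTorusObservable (Lseq k + 1) Φ₁ V ∂(wilsonMeasure (d := d) (L := Lseq k + 1) ρG β)) *
            ∫ V, toTorusObservable (Lseq k + 1) Φ₂ V
              ∂(wilsonMeasure (d := d) (L := Lseq k + 1) ρG β)| ≤ b) :
    |cov[Φ₁, Φ₂; μ]| ≤ b := by
  obtain ⟨hprob, hlim⟩ := hμL
  have hcov : cov[Φ₁, Φ₂; μ] = (∫ U, Φ₁ U * Φ₂ U ∂μ) - (∫ U, Φ₁ U ∂μ) * ∫ U, Φ₂ U ∂μ := by
    have l₁ : MemLp Φ₁ 2 μ := memLp_of_bounded (a := -M₁) (b := M₁)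
      (ae_of_all _ fun U => abs_le.1 (hM₁ U)) h₁m.aestronglyMeasurable 2
    have l₂ : MemLp Φ₂ 2 μ := memLp_of_bounded (a := -M₂) (b := M₂)
      (ae_of_all _ fun U => abs_le.1 (hM₂ U)) h₂m.aestronglyMeasurable 2
    exact covariance_eq_sub l₁ l₂
  rw [hcov]
  have hP : IsCylinder (fun U => Φ₁ U * Φ₂ U) (T₁ ∪ T₂) := IsCylinder.mul h₁T h₂T
  have t1 := hlim (fun U => Φ₁ U * Φ₂ U) _ hP (h₁c.mul h₂c)
    ⟨M₁ * M₂, fun U => abs_mul_le_of_abs_le hM₁ hM₂ U⟩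
  have t2 := hlim Φ₁ T₁ h₁T h₁c ⟨M₁, hM₁⟩
  have t3 := hlim Φ₂ T₂ h₂T h₂c ⟨M₂, hM₂⟩
  have t := (t1.sub (t2.mul t3)).abs
  refine le_of_tendsto t ?_
  unfold wilsonExpectation
  exact hB

end WeakLimit

/-! ### Lipschitz cylinder functions read through the periodic lift are link observables -/

section Lipschitz

variable {d N : ℕ} {L : ℕ} [NeZero L]

/-- Lipschitz cylinder functions are continuous. -/
theorem continuous_of_isLipschitzCylinder
    {F : LGConfig d (Matrix.specialUnitaryGroup (Fin N) ℂ) → ℝ}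
    {Λ : Finset (Literature.MathematicalPhysics.QuantumLattice.ZdEdge d)} {K : ℝ≥0}
    (hF : IsLipschitzCylinder (fundamentalRep (Fin N)) F Λ K) : Continuous F := by
  obtain ⟨f, hf, hFf⟩ := hF.exists_suEntries
  have : F = f ∘ fun U (e : ↥Λ) => suEntries (U e) := funext hFf
  rw [this]
  exact hf.continuous.comp (continuous_pi fun e => continuous_suEntries.comp (continuous_apply _))

omit [NeZero L] in
/-- **A Lipschitz cylinder function of `ℤ^d`, read through the periodic lift, is an admissible link
observable of the torus** with support the projected links and per-link Lipschitz constant `K` for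
the Frobenius weight `suFrobDist`, provided `torusEdge L` is injective on the support. -/
theorem linkObs_toTorusObservable
    {F : LGConfig d (Matrix.specialUnitaryGroup (Fin N) ℂ) → ℝ}
    {Λ : Finset (Literature.MathematicalPhysics.QuantumLattice.ZdEdge d)} {K : ℝ≥0}
    (hF : IsLipschitzCylinder (fundamentalRep (Fin N)) F Λ K)
    (hinj : ∀ e ∈ Λ, ∀ e' ∈ Λ, torusEdge L e = torusEdge L e' → e = e') :
    LinkObs suFrobDist (toTorusObservable L F) (Λ.image (torusEdge L)) (fun _ => (K : ℝ)) := by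
  classical
  have hA : ∀ a b : Matrix.specialUnitaryGroup (Fin N) ℂ,
      dist (suEntries a) (suEntries b) ≤ 1 * suFrobDist a b := fun a b => by
    rw [one_mul]; exact dist_suEntries_le_suFrobDist a b
  have hlip := hF.isLipBound zero_le_one hA
  refine ⟨hF.measurable.comp (measurable_torusLift L), ⟨|F 1| + 2 * K, fun V => hF.abs_le _⟩,
    dependsOn_toTorusObservable L hF.isCylinder, fun _ => K.2, fun y σ τ hστ => ?_⟩
  simp only [toTorusObservable_apply]
  by_cases hy : ∃ e ∈ Λ, torusEdge L e = y
  · obtain ⟨e₀, he₀, rfl⟩ := hy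
    -- replace `lift σ` by `lift τ` updated at `e₀`
    have h1 : F (torusLift L σ) =
        F (Function.update (torusLift L τ) e₀ (σ (torusEdge L e₀))) := by
      refine hF.dependsOn fun e he => ?_
      by_cases hee : e = e₀
      · subst hee
        rw [Function.update_self]; rfl
      · rw [Function.update_of_ne hee]
        have hne : torusEdge L e ≠ torusEdge L e₀ := fun h =>
          hee (hinj e (Finset.mem_coe.1 he) e₀ he₀ h)
        exact hστ _ hne
    have h2 := hlip.le e₀ (Function.update (torusLift L τ) e₀ (σ (torusEdge L e₀))) (torusLift L τ)
      (fun z hz => by rw [Function.update_of_ne hz])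
    rw [if_pos he₀, one_mul, Function.update_self] at h2
    rw [h1]
    exact h2
  · push Not at hy
    have h1 : F (torusLift L σ) = F (torusLift L τ) :=
      hF.dependsOn fun e he => hστ _ (hy e (Finset.mem_coe.1 he))
    rw [h1, sub_self, abs_zero]
    exact mul_nonneg K.2 (suFrobDist_nonneg _ _)

end Lipschitz

/-! ### One torus: the star door for Lipschitz cylinder functions of `ℤ⁴` -/

section Torus

variable {L : ℕ} [NeZero L]

/-- **Torus covariance bound for two Lipschitz cylinder functions of `ℤ⁴` read through the periodic
lift** (`SU(2)`, `d = 4`, torus carrying `StarWindowBound L β_W ρ suFrobDist`, `ρ < 1`): if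
`torusEdge L` is injective on each support and the projected base points of `Λ₁`, `Λ₂` are `≥ m`
apart in the periodic sup-distance, then under the torus Wilson measure at tree coupling `β_W/2`
`|cov(F₁∘lift, F₂∘lift)| ≤ 4(2√2)² e^{−κ(ρ)(m − 2)} (#Λ₁ K₁)(#Λ₂ K₂)` (ds-1's
`su2Star_abs_covariance_le`; no separation of the supports is needed). -/
theorem su2Star_torus_cov_lipschitz (βW : ℝ) {ρ : ℝ} (hρ0 : 0 ≤ ρ) (hρ1 : ρ < 1)
    (hS : StarWindowBound L βW ρ suFrobDist)
    {F₁ F₂ : LGConfig 4 (Matrix.specialUnitaryGroup (Fin 2) ℂ) → ℝ}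
    {Λ₁ Λ₂ : Finset (Literature.MathematicalPhysics.QuantumLattice.ZdEdge 4)} {K₁ K₂ : ℝ≥0}
    (hF₁ : IsLipschitzCylinder (fundamentalRep (Fin 2)) F₁ Λ₁ K₁)
    (hF₂ : IsLipschitzCylinder (fundamentalRep (Fin 2)) F₂ Λ₂ K₂)
    (hinj₁ : ∀ e ∈ Λ₁, ∀ e' ∈ Λ₁, torusEdge L e = torusEdge L e' → e = e')
    (hinj₂ : ∀ e ∈ Λ₂, ∀ e' ∈ Λ₂, torusEdge L e = torusEdge L e' → e = e') {m : ℕ}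
    (hgeom : ∀ a ∈ Λ₁, ∀ b ∈ Λ₂, m ≤ torusNorm ((torusEdge L a).1 - (torusEdge L b).1)) :
    |cov[toTorusObservable L F₁, toTorusObservable L F₂;
        wilsonMeasure (d := 4) (L := L) (fundamentalRep (Fin 2)) (βW / 2)]| ≤
      4 * (2 * Real.sqrt 2) ^ 2 * Real.exp (-(starRate ρ * ((m - 2 : ℕ) : ℝ))) *
        ((Λ₁.card : ℝ) * K₁) * ((Λ₂.card : ℝ) * K₂) := by
  classical
  have hfo := linkObs_toTorusObservable (L := L) hF₁ hinj₁
  have hgo := linkObs_toTorusObservable (L := L) hF₂ hinj₂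
  have hL₀ : ∀ x ∈ Λ₁.image (torusEdge L), ∀ z ∈ Λ₂.image (torusEdge L),
      ∀ a ∈ linkEnds x, ∀ w ∈ linkEnds z, m - 2 ≤ torusNorm (a - w) := by
    intro x hx z hz a ha w hw
    obtain ⟨a₁, ha₁, rfl⟩ := Finset.mem_image.1 hx
    obtain ⟨b₁, hb₁, rfl⟩ := Finset.mem_image.1 hz
    have h2 := hgeom a₁ ha₁ b₁ hb₁
    have htri : torusNorm ((torusEdge L a₁).1 - (torusEdge L b₁).1) ≤ 1 + torusNorm (a - w) + 1 := by
      calc torusNorm ((torusEdge L a₁).1 - (torusEdge L b₁).1)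
          ≤ torusNorm ((torusEdge L a₁).1 - a) + torusNorm (a - (torusEdge L b₁).1) :=
            torusNorm_sub_le _ _ _
        _ ≤ torusNorm ((torusEdge L a₁).1 - a) + (torusNorm (a - w) + torusNorm (w - (torusEdge L b₁).1)) :=
            Nat.add_le_add_left (torusNorm_sub_le _ _ _) _
        _ ≤ 1 + (torusNorm (a - w) + 1) := by
            refine Nat.add_le_add (torusNorm_fst_sub_linkEnds_le_one _ ha) (Nat.add_le_add_left ?_ _)
            rw [← torusNorm_neg, neg_sub]; exact torusNorm_fst_sub_linkEnds_le_one _ hw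
        _ = 1 + torusNorm (a - w) + 1 := by ring
    omega
  have hR2 : (0 : ℝ) ≤ 2 * Real.sqrt 2 := by positivity
  have key := su2Star_abs_covariance_le (L := L) βW hR2 suFrobDist_le hρ0 hρ1 hS hfo hgo (m - 2) hL₀
  refine key.trans ?_
  rw [starRate, Finset.sum_const, Finset.sum_const, nsmul_eq_mul, nsmul_eq_mul]
  have hK₁ : (0 : ℝ) ≤ K₁ := K₁.2
  have hK₂ : (0 : ℝ) ≤ K₂ := K₂.2
  have hc₁ : ((Λ₁.image (torusEdge L)).card : ℝ) ≤ Λ₁.card := by exact_mod_cast Finset.card_image_le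
  have hc₂ : ((Λ₂.image (torusEdge L)).card : ℝ) ≤ Λ₂.card := by exact_mod_cast Finset.card_image_le
  have hP : 0 ≤ 4 * (2 * Real.sqrt 2) ^ 2 *
      Real.exp (-((1 - ρ) ^ 2 / (2 * (16 * ρ + 1)) * ((m - 2 : ℕ) : ℝ))) := by positivity
  have hA : ((Λ₁.image (torusEdge L)).card : ℝ) * K₁ ≤ (Λ₁.card : ℝ) * K₁ :=
    mul_le_mul_of_nonneg_right hc₁ hK₁
  have hB : ((Λ₂.image (torusEdge L)).card : ℝ) * K₂ ≤ (Λ₂.card : ℝ) * K₂ :=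
    mul_le_mul_of_nonneg_right hc₂ hK₂
  have hB0 : 0 ≤ ((Λ₂.image (torusEdge L)).card : ℝ) * K₂ := by positivity
  have hA1 : 0 ≤ (Λ₁.card : ℝ) * K₁ := by positivity
  exact mul_le_mul (mul_le_mul_of_nonneg_left hA hP) hB hB0 (mul_nonneg hP hA1)

end Torus

end Summit.Ventures.YMGap.StarLimit

end
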